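import Summits.Ventures.Crystal3D.Theorems.StickyWulffConstantCoaxialWallLawBiPlanarRow
import HarnessLib

/-!
# `BiPlanarEndRow τ` — the planar-heights kissing row of the (F-γ) bi-planar rung (DEFINITIONS file)

HONEST FRAMING. Part of the venture `Summits/Ventures/Crystal3D` (cell `crystal3d-full`), helper
`--supports` the crux `CoaxialWallLaw` (stmt-Ventures-19481, `route-Ventures-StickyWulffConstant`),
REGISTERED line `WallLedgerF`, open stub `stub_coaxialTwoSlabAdhesion`.  RUNG CREDIT ONLY; F-C1 not moved.

This file NAMES the row used as an explicit hypothesis in `…CoaxialWallLawBiPlanarRow` (a ROUTE-INTERNAL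
census/certificate target, not a published fact — same status as `KFoldTopDeficit` of `…KFoldTop`):

* `BiPlanarEndRow τ` — for a unit axis `m`, an in-plane unit vector `d` and a finite set `S` of unit
  vectors, pairwise at distance `≥ 1`, each at frame height `⟪v, m⟫ ∈ √(2/3)·(ℤ ∪ (ℤ + τ))`, with
  `−d ∈ S` and `d ∉ S`: `#S ≤ 11`.  These are exactly the contact directions of a located in-plane run end
  in a BI-PLANAR filling (every ball on a basal plane of either grain) of a co-axial pair with height offset
  `τ`.  Numerics of this seat (kit j306954, exact enumeration of cyclic species patterns + difference
  constraints): TRUE for every `τ ∉ ⅓ℤ`; FALSE exactly at `τ ≡ ±⅓ (mod 1)` (the inclined twin dozen is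
  bi-planar there); at `τ ∈ ℤ` it is the laminar row (`…LaminarEnd`).
* `coaxialTwoSlabAdhesion_biPlanar_of_row` — `…BiPlanarRow.coaxialTwoSlabAdhesion_biPlanar_of` with the
  named hypothesis `BiPlanarEndRow ((L⁻¹(s₂ − s₁))₂ / √(2/3))`: the (F-γ) bi-planar rung at `√6/4` MODULO the
  row.

WHAT THIS IS NOT: the row is not proved here for any `τ`; F-C1 not moved.
-/

noncomputable section

namespace Summit.Ventures.Crystal3D.Theorems

open Summit.Ventures.Crystal3D Finset
open Literature.MathematicalPhysics.StatisticalMechanics (fccStacking barlowStacking IsHaggSeq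
  contactDeficiency)
open scoped InnerProductSpace

/-- **The planar-heights kissing row at offset `τ`** (route-internal certificate target).  For a unit
axis `m`, an in-plane unit vector `d` and a finite set `S` of unit vectors, pairwise at distance `≥ 1`,
each at frame height `⟪v, m⟫ ∈ √(2/3)·(ℤ ∪ (ℤ + τ))`, with `−d ∈ S` and `d ∉ S`: `#S ≤ 11`. -/
def BiPlanarEndRow (τ : ℝ) : Prop :=
  ∀ (m d : EuclideanSpace ℝ (Fin 3)) (S : Finset (EuclideanSpace ℝ (Fin 3))),
    ‖m‖ = 1 → ‖d‖ = 1 → ⟪d, m⟫_ℝ = 0 →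
    (∀ v ∈ S, ‖v‖ = 1) →
    (∀ v ∈ S, ∃ k : ℤ, ⟪v, m⟫_ℝ = k * Real.sqrt (2 / 3) ∨ ⟪v, m⟫_ℝ = (k + τ) * Real.sqrt (2 / 3)) →
    (∀ v ∈ S, ∀ w ∈ S, v ≠ w → 1 ≤ dist v w) →
    -d ∈ S → d ∉ S → S.card ≤ 11

open scoped Classical in
/-- **The (F-γ) bi-planar rung of `stub_coaxialTwoSlabAdhesion` modulo `BiPlanarEndRow`** (explicit
frame, height-incommensurate pair, constant `√6/4 ≥ ½`): every BI-PLANAR filling (every ball on a basal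
plane of grain 1 or of grain 2, in-plane positions free) satisfies
`cross ≤ D(Y) + (φ₁ + φ₂ − (√6/4)·sin θ)πρ² + C(1+h)ρ`. -/
theorem coaxialTwoSlabAdhesion_biPlanar_of_row
    (A₁ : EuclideanSpace ℝ (Fin 3) ≃ₗᵢ[ℝ] EuclideanSpace ℝ (Fin 3)) (t₁ : EuclideanSpace ℝ (Fin 3))
    (A₂ : EuclideanSpace ℝ (Fin 3) ≃ₗᵢ[ℝ] EuclideanSpace ℝ (Fin 3)) (t₂ : EuclideanSpace ℝ (Fin 3))
    (L : EuclideanSpace ℝ (Fin 3) ≃ₗᵢ[ℝ] EuclideanSpace ℝ (Fin 3)) (s₁ s₂ : EuclideanSpace ℝ (Fin 3))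
    {σ σ' : ℤ → ℤ} (hσ : IsHaggSeq σ) (hσ' : IsHaggSeq σ')
    (hsub₁ : (fun p => A₁ p + t₁) '' fccStacking 1 (Real.sqrt (2 / 3)) ⊆
      (fun p => L p + s₁) '' barlowStacking 1 (Real.sqrt (2 / 3)) σ)
    (hsub₂ : (fun p => A₂ p + t₂) '' fccStacking 1 (Real.sqrt (2 / 3)) ⊆
      (fun p => L p + s₂) '' barlowStacking 1 (Real.sqrt (2 / 3)) σ')
    (hinc : ¬ ∃ k₀ : ℤ, (L.symm (s₂ - s₁)) 2 = k₀ * Real.sqrt (2 / 3))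
    (hrow : BiPlanarEndRow ((L.symm (s₂ - s₁)) 2 / Real.sqrt (2 / 3))) :
    ∃ C : ℝ, ∀ h : ℝ, 0 ≤ h → ∀ ρ : ℝ, 10 ≤ ρ →
      ∀ X P₁ P₂ : Finset (EuclideanSpace ℝ (Fin 3)),
      (∀ p ∈ X, ∀ q ∈ X, p ≠ q → 1 ≤ dist p q) → P₁ ⊆ X → P₂ ⊆ X \ P₁ →
      (∀ p ∈ X, -(2 * 10) ≤ p 2 ∧ p 2 ≤ h + 2 * 10 ∧ p 0 ^ 2 + p 1 ^ 2 ≤ ρ ^ 2) →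
      (∀ p, p ∈ P₁ ↔ (p ∈ (fun q => A₁ q + t₁) '' fccStacking 1 (Real.sqrt (2 / 3)) ∧
        -(2 * 10) ≤ p 2 ∧ p 2 ≤ -10 ∧ p 0 ^ 2 + p 1 ^ 2 ≤ ρ ^ 2)) →
      (∀ p, p ∈ P₂ ↔ (p ∈ (fun q => A₂ q + t₂) '' fccStacking 1 (Real.sqrt (2 / 3)) ∧
        h + 10 ≤ p 2 ∧ p 2 ≤ h + 2 * 10 ∧ p 0 ^ 2 + p 1 ^ 2 ≤ ρ ^ 2)) →
      (∀ p ∈ X, (∃ k : ℤ, (L.symm (p - s₁)) 2 = k * Real.sqrt (2 / 3)) ∨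
        (∃ k : ℤ, (L.symm (p - s₂)) 2 = k * Real.sqrt (2 / 3))) →
      ((((P₁ ×ˢ (X \ P₁)).filter fun pq => dist pq.1 pq.2 = 1).card : ℕ) : ℝ) +
        ((((P₂ ×ˢ ((X \ P₁) \ P₂)).filter fun pq => dist pq.1 pq.2 = 1).card : ℕ) : ℝ) ≤
        contactDeficiency ((X \ P₁) \ P₂) +
          (Real.sqrt 2 / 4 * ∑ᶠ w ∈ {w ∈ fccStacking 1 (Real.sqrt (2 / 3)) | ‖w‖ = 1},
              |⟪w, A₁.symm (EuclideanSpace.single (2 : Fin 3) (1 : ℝ))⟫_ℝ| +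
            Real.sqrt 2 / 4 * ∑ᶠ w ∈ {w ∈ fccStacking 1 (Real.sqrt (2 / 3)) | ‖w‖ = 1},
              |⟪w, A₂.symm (EuclideanSpace.single (2 : Fin 3) (1 : ℝ))⟫_ℝ| -
            (Real.sqrt 6 / 4 : ℝ) * Real.sqrt (1 - ⟪L (EuclideanSpace.single (2 : Fin 3) (1 : ℝ)),
              (EuclideanSpace.single (2 : Fin 3) (1 : ℝ))⟫_ℝ ^ 2)) * Real.pi * ρ ^ 2 +
          C * (1 + h) * ρ := by
  have hs0 : 0 < Real.sqrt (2 / 3) := Real.sqrt_pos.2 (by norm_num)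
  have hτ : (L.symm (s₂ - s₁)) 2 = ((L.symm (s₂ - s₁)) 2 / Real.sqrt (2 / 3)) * Real.sqrt (2 / 3) := by
    rw [div_mul_cancel₀ _ hs0.ne']
  exact coaxialTwoSlabAdhesion_biPlanar_of A₁ t₁ A₂ t₂ L s₁ s₂ hσ hσ' hsub₁ hsub₂ hinc hτ hrow

end Summit.Ventures.Crystal3D.Theorems

end
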